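import Summits.Ventures.PercRepro.GenQNineSevenShares
import Summits.Ventures.PercRepro.GenQCovering
import Summits.Ventures.PercRepro.GenQOpenLayersCoreSmall
import Summits.Ventures.PercRepro.GenQOpenLayersCoreFree

/-!
# PercRepro — THE `t = 2` WINDOW OF THE `(9, 7)` ROW ON THE CORE, IN THE KERNEL (night-4, gen 3; sheet §49)

The type-`2` balance `0 ≤ Jq M G 7 2` on every coloop-free rank-`7` flat `G` with at most `14` points of a Core
matroid, by the two charging layers (`GenQNineSevenShares.lean`) and — for the first time — the covering structure of
a coloop-free flat (`GenQCovering.lean`): with `k = #(G ∖ B₀)` and `k₃` points of circuit size `3`, the per-element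
bounds carry every `(k, k₃)` except `(4, 4)` (`charge_arith_seven`); when `k = k₃ = 4` the four `3`-circuits cover the
seven basis points, so at most one pair of traces meets (`card_meetingPairs_le_one`) and the charge is at least
`4/72 + 11/400 + 5/24 = 0.291 ≥ 1/4` (`charge_arith_seven_special`).

Main statements: `jq_two_nonneg_of_core_seven`, `NineSevenResidueCoreFree` (the `t = 1` window `9 ≤ g ≤ 11` and the
`t = 3 … 6` balances on coloop-free flats — the exact remaining gap of the row `(9, 7)` at level `7`),
`openLayersCoreFree_seven_of_residue`, `rls_nine_seven_of_residue`.
-/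

namespace PercRepro.GenQ

open Finset ThmH PerFlat SixFour ThmN NightThree

variable {α : Type*} [DecidableEq α] {M : Matroid α} [M.Finite]

/-! ## The charge of a demanding basis is at least `1/4` -/

/-- The arithmetic of the two layers at `q = 7` for every `(k, k₃)` with `k ∈ [2, 7]` except `(4, 4)`. -/
theorem charge_arith_seven (k k₃ : ℕ) (hk : 2 ≤ k) (hk7 : k ≤ 7) (hk₃ : k₃ ≤ k) (hne : ¬ (k = 4 ∧ k₃ = 4))
    (d₁ d₂ : ℚ) (hd₁0 : 0 ≤ d₁) (hd₁1 : d₁ ≤ 1) (hd₂0 : 0 ≤ d₂) (hd₂1 : d₂ ≤ 1) (hd₁ : k ≤ 2 → d₁ = 0)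
    (hd₂ : k ≤ 3 → d₂ = 0) :
    1 / 4 ≤ (k₃ : ℚ) * ((7 / 6 - 9 / 8 * d₁) / 3) + ((k - k₃ : ℕ) : ℚ) * ((7 / 5 - 9 / 8 * d₁) / 4) +
      ((k.choose 2 : ℕ) : ℚ) * (1 / 9 - (1 / 9 - 11 / 400) * d₂) := by
  interval_cases k <;> interval_cases k₃ <;> norm_num [Nat.choose] at hd₁ hd₂ ⊢ <;>
    first | exact absurd ⟨rfl, rfl⟩ hne | (subst hd₁; subst hd₂; norm_num) | (subst hd₂; linarith) | linarith

/-- The arithmetic of the special case `k = k₃ = 4`: at most one meeting pair. -/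
theorem charge_arith_seven_special (f : ℕ) (hf : f ≤ 1) (hf6 : f ≤ 6) :
    1 / 4 ≤ (4 : ℚ) * ((7 / 6 - 9 / 8) / 3) + (f : ℚ) * (11 / 400) + ((6 - f : ℕ) : ℚ) * (1 / 24) := by
  interval_cases f <;> norm_num

/-- **Every basis `B₀` of a coloop-free `G` with `2 ≤ #(G ∖ B₀) ≤ 7` is charged at least `1/4`** at `q = 7`
(lines `≤ 3` points). -/
theorem nineSeven_charge_ge (hs : Simple M) (hline : ∀ L ∈ flatsQ M 2, L.card ≤ 3) {G B₀ : Finset α}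
    (hG : G ⊆ gr M) (hrG : M.eRk (G : Set α) = ((7 : ℕ) : ℕ∞)) (hB : B₀ ∈ basesOf M G 7) (hfree : mTr M G = 0)
    (hk : 2 ≤ (G \ B₀).card) (hk7 : (G \ B₀).card ≤ 7) : 1 / 4 ≤ charge M G 7 B₀ := by
  set K := G \ B₀ with hK
  set K₃ := K.filter (fun x => (fc M x B₀).card = 3) with hK₃
  set D₁ : ℚ := if K.card ≤ 2 then 0 else 1 with hD₁
  set D₂ : ℚ := if K.card ≤ 3 then 0 else 1 with hD₂
  have hK₃K : K₃ ⊆ K := Finset.filter_subset _ _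
  have hdem₁ : ∀ x ∈ K, dem M G 2 (insert x B₀) ≤ D₁ := by
    intro x hxK
    rw [hD₁]
    split_ifs with hk2
    · rw [dem_two_eq_zero_of_card_le_one]
      have : G \ insert x B₀ = K.erase x := by
        ext e
        simp only [Finset.mem_sdiff, Finset.mem_insert, Finset.mem_erase, hK]
        tauto
      rw [this, Finset.card_erase_of_mem hxK]
      omega
    · exact dem_le_one G (insert x B₀) 2
  have hdem₂ : ∀ P ∈ K.powersetCard 2, dem M G 2 (B₀ ∪ P) ≤ D₂ := by
    intro P hP
    obtain ⟨hPsub, hPc⟩ := Finset.mem_powersetCard.1 hP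
    rw [hD₂]
    split_ifs with hk3
    · rw [dem_two_eq_zero_of_card_le_one]
      have : G \ (B₀ ∪ P) = K \ P := by
        ext e
        simp only [Finset.mem_sdiff, Finset.mem_union, hK]
        tauto
      rw [this, Finset.card_sdiff_of_subset hPsub, hPc]
      omega
    · exact dem_le_one G (B₀ ∪ P) 2
  -- the singleton bounds
  have hσ₃ : ∀ x ∈ K, (fc M x B₀).card = 3 →
      (7 / 6 - 9 / 8 * D₁) / 3 ≤ wTwo M G (insert x B₀) 7 / nb M G (insert x B₀) 7 := by
    intro x hx hcx
    have hxG : x ∈ G := (Finset.mem_sdiff.1 hx).1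
    have hxB : x ∉ B₀ := (Finset.mem_sdiff.1 hx).2
    refine le_trans ?_ (single_share_seven_of_three hs hG hrG hB hxG hxB hcx)
    have := hdem₁ x hx
    rw [div_le_div_iff_of_pos_right (by norm_num)]
    linarith
  have hσ₄ : ∀ x ∈ K, (fc M x B₀).card ≠ 3 →
      (7 / 5 - 9 / 8 * D₁) / 4 ≤ wTwo M G (insert x B₀) 7 / nb M G (insert x B₀) 7 := by
    intro x hx hcx
    have hxG : x ∈ G := (Finset.mem_sdiff.1 hx).1
    have hxB : x ∉ B₀ := (Finset.mem_sdiff.1 hx).2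
    have h3 := three_le_card_fc hs ((mem_basesOf.1 hB).1.trans hG) (hG hxG) (indep_of_mem_basesOf hB)
      (mem_closure_of_mem_basesOf hG hrG hB hxG) hxB (Finset.card_pos.1 (by rw [(mem_basesOf.1 hB).2.2]; norm_num))
    refine le_trans ?_ (single_share_seven_of_ge_four hs hG hrG hB hxG hxB (by omega))
    have := hdem₁ x hx
    rw [div_le_div_iff_of_pos_right (by norm_num)]
    linarith
  -- a pair `P = {x, y}` and its two bounds
  have hpair : ∀ P ∈ K.powersetCard 2, ∃ x y, x ≠ y ∧ P = {x, y} ∧ x ∈ G ∧ x ∉ B₀ ∧ y ∈ G ∧ y ∉ B₀ ∧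
      B₀ ∪ P = insert y (insert x B₀) := by
    intro P hP
    obtain ⟨hPsub, hPc⟩ := Finset.mem_powersetCard.1 hP
    obtain ⟨x, y, hxy, hPxy⟩ := Finset.card_eq_two.1 hPc
    have hxP : x ∈ P := by rw [hPxy]; exact Finset.mem_insert_self x {y}
    have hyP : y ∈ P := by rw [hPxy]; exact Finset.mem_insert_of_mem (Finset.mem_singleton_self y)
    exact ⟨x, y, hxy, hPxy, (Finset.mem_sdiff.1 (hPsub hxP)).1, (Finset.mem_sdiff.1 (hPsub hxP)).2,
      (Finset.mem_sdiff.1 (hPsub hyP)).1, (Finset.mem_sdiff.1 (hPsub hyP)).2, by rw [hPxy, SixFour.union_pair_eq]⟩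
  by_cases hspecial : K.card = 4 ∧ K₃.card = 4
  · -- all four circuits are `3`-circuits: at most one pair of traces meets
    obtain ⟨hk4, hk₃4⟩ := hspecial
    have hK₃eq : K₃ = K := Finset.eq_of_subset_of_card_le hK₃K (by omega)
    have hall : ∀ x ∈ K, (fc M x B₀).card - 1 = 2 := by
      intro x hx
      rw [← hK₃eq, hK₃, Finset.mem_filter] at hx
      omega
    have hS : ∑ x ∈ G \ B₀, ((fc M x B₀).card - 1) ≤ 7 + 1 := by
      rw [← hK, Finset.sum_congr rfl hall, Finset.sum_const, smul_eq_mul, hk4]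
    have hD₁1 : D₁ = 1 := by rw [hD₁, if_neg (by omega)]
    have hD₂1 : D₂ = 1 := by rw [hD₂, if_neg (by omega)]
    have hF := card_meetingPairs_le_one hG hrG hB hfree hS
    rw [← hK] at hF
    have h := charge_ge_of_bounds' hs hG hrG hB (by norm_num) ((7 / 6 - 9 / 8 * D₁) / 3) ((7 / 5 - 9 / 8 * D₁) / 4)
      (fun P => if MeetingPair M B₀ P then (11 / 400 : ℚ) else 1 / 24) hσ₃ hσ₄ ?_
    · rw [← hK, ← hK₃, hk4, hk₃4, Finset.sum_ite, Finset.sum_const, Finset.sum_const, nsmul_eq_mul, nsmul_eq_mul] at h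
      have hcnt := Finset.card_filter_add_card_filter_not (s := K.powersetCard 2) (fun P => MeetingPair M B₀ P)
      rw [Finset.card_powersetCard, hk4] at hcnt
      have hnot : ((K.powersetCard 2).filter (fun P => ¬ MeetingPair M B₀ P)).card =
          6 - ((K.powersetCard 2).filter (fun P => MeetingPair M B₀ P)).card := by
        have : Nat.choose 4 2 = 6 := by decide
        omega
      rw [hnot] at h
      have harith := charge_arith_seven_special ((K.powersetCard 2).filter (fun P => MeetingPair M B₀ P)).card hF
        (by have : Nat.choose 4 2 = 6 := by decide
            omega)
      rw [hD₁1] at h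
      norm_num at h harith ⊢
      linarith
    · intro P hP
      obtain ⟨x, y, hxy, hPxy, hxG, hxB, hyG, hyB, hunion⟩ := hpair P hP
      have hd := hdem₂ P hP
      rw [hunion] at hd ⊢
      have haux := pair_share_seven_ge_aux hs hG hrG hB hyG hyB hxG hxB hxy.symm
        (five_le_card_union_fc hs hline hG hrG hB (by norm_num) hyG hyB hxG hxB hxy.symm)
      split_ifs with hmeet
      · refine le_trans ?_ haux.1
        linarith
      · -- disjoint traces: `u = 6`
        have hdisj : ¬ ((fc M y B₀).erase y ∩ (fc M x B₀).erase x).Nonempty := by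
          intro hne
          apply hmeet
          refine ⟨y, ?_, x, ?_, hxy.symm, hne⟩
          · rw [hPxy]; exact Finset.mem_insert_of_mem (Finset.mem_singleton_self y)
          · rw [hPxy]; exact Finset.mem_insert_self x {y}
        have hu := card_union_fc_of_disjoint_traces (M := M) hyB hxB hxy.symm hdisj
        have h3x := three_le_card_fc hs ((mem_basesOf.1 hB).1.trans hG) (hG hxG) (indep_of_mem_basesOf hB)
          (mem_closure_of_mem_basesOf hG hrG hB hxG) hxB
          (Finset.card_pos.1 (by rw [(mem_basesOf.1 hB).2.2]; norm_num))
        have h3y := three_le_card_fc hs ((mem_basesOf.1 hB).1.trans hG) (hG hyG) (indep_of_mem_basesOf hB)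
          (mem_closure_of_mem_basesOf hG hrG hB hyG) hyB
          (Finset.card_pos.1 (by rw [(mem_basesOf.1 hB).2.2]; norm_num))
        refine le_trans ?_ (haux.2 (by omega))
        linarith
  · -- the generic arithmetic
    have h := charge_ge_of_bounds hs hG hrG hB (by norm_num) ((7 / 6 - 9 / 8 * D₁) / 3) ((7 / 5 - 9 / 8 * D₁) / 4)
      (1 / 9 - (1 / 9 - 11 / 400) * D₂) hσ₃ hσ₄ ?_
    · have harith := charge_arith_seven K.card K₃.card hk hk7 (Finset.card_le_card hK₃K) hspecial D₁ D₂
        (by rw [hD₁]; split_ifs <;> norm_num) (by rw [hD₁]; split_ifs <;> norm_num)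
        (by rw [hD₂]; split_ifs <;> norm_num) (by rw [hD₂]; split_ifs <;> norm_num)
        (fun h2 => by rw [hD₁, if_pos h2]) (fun h3 => by rw [hD₂, if_pos h3])
      linarith
    · intro P hP
      obtain ⟨x, y, hxy, _, hxG, hxB, hyG, hyB, hunion⟩ := hpair P hP
      have hd := hdem₂ P hP
      rw [hunion] at hd ⊢
      have haux := pair_share_seven_ge_aux hs hG hrG hB hyG hyB hxG hxB hxy.symm
        (five_le_card_union_fc hs hline hG hrG hB (by norm_num) hyG hyB hxG hxB hxy.symm)
      refine le_trans ?_ haux.1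
      linarith

/-! ## The `t = 2` window of `(9, 7)` -/

/-- **The type-`2` balance on every coloop-free rank-`7` flat with at most `14` points when lines have `≤ 3`
points.** -/
theorem jq_two_nonneg_of_lines_seven (hs : Simple M) (hline : ∀ L ∈ flatsQ M 2, L.card ≤ 3) {G : Finset α}
    (hG : G ∈ flatsQ M 7) (hfree : mTr M G = 0) (hcard : G.card ≤ 14) : 0 ≤ Jq M G 7 2 := by
  have hGg : G ⊆ gr M := (mem_flatsQ.1 hG).1
  have hrG : M.eRk (G : Set α) = ((7 : ℕ) : ℕ∞) := (mem_flatsQ.1 hG).2.2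
  apply Jq_two_nonneg_of_charge
  intro B₀ hB
  obtain ⟨hBG, hr, hc⟩ := mem_basesOf.1 hB
  have hkc : (G \ B₀).card = G.card - 7 := by rw [Finset.card_sdiff_of_subset hBG, hc]
  have hw : -(1 / 4 : ℚ) ≤ wTwo M G B₀ 7 := by
    unfold wTwo wInf
    have hm : mTr M B₀ ≤ 7 := mTr_le_of_eRk_eq (hBG.trans hGg) hr
    have hm' : (mTr M B₀ : ℚ) ≤ 7 := by exact_mod_cast hm
    have hwinf : (1 : ℚ) / 8 ≤ 1 / (1 + (mTr M B₀ : ℚ)) := one_div_le_one_div_of_le (by positivity) (by linarith)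
    have hd := dem_le_one (M := M) G B₀ 2
    push_cast
    nlinarith
  by_cases hk : (G \ B₀).card ≤ 1
  · have hd0 : dem M G 2 B₀ = 0 := dem_two_eq_zero_of_card_le_one hk
    have hw0 : 0 ≤ wTwo M G B₀ 7 := by
      unfold wTwo
      rw [hd0]
      have := wInf_pos (M := M) B₀
      push_cast
      nlinarith
    have hch : 0 ≤ charge M G 7 B₀ := by
      have := charge_ge_sum_of_subset (q := 7) hs hGg (by norm_num) B₀ (T := ∅) (Finset.empty_subset _)
      rwa [Finset.sum_empty] at this
    linarith
  · have hch := nineSeven_charge_ge hs hline hGg hrG hB hfree (by omega) (by omega)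
    linarith

/-- **THE `t = 2` WINDOW OF THE `(9, 7)` ROW ON THE CORE**: on every Core matroid, every coloop-free rank-`7` flat
with at most `14` points satisfies the type-`2` balance `0 ≤ Jq M G 7 2`. -/
theorem jq_two_nonneg_of_core_seven {γ : Type} [DecidableEq γ] {M : Matroid γ} [M.Finite] {p : ℕ} (hc : Core M p)
    {G : Finset γ} (hG : G ∈ flatsQ M 7) (hfree : mTr M G = 0) (hcard : G.card ≤ 14) : 0 ≤ Jq M G 7 2 :=
  jq_two_nonneg_of_lines_seven (simple_of_core hc) (fun _ hL => card_le_three_of_line_of_core hc hL) hG hfree hcard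

/-- **The residue of the row `(9, 7)` at level `7`** on the coloop-free flats: the type-`1` balance when
`9 ≤ #G ≤ 11` and the type-`3 … 6` balances — `OpenLayersCoreFree 7` without its type-`2` clause. -/
def NineSevenResidueCoreFree : Prop :=
  ∀ {β : Type} [DecidableEq β] (M : Matroid β) [M.Finite] (G : Finset β), Core M 9 → G ∈ flatsQ M 7 →
    mTr M G = 0 → (9 ≤ G.card → G.card ≤ 11 → 0 ≤ Jq M G 7 1) ∧ (∀ t, 3 ≤ t → t ≤ 6 → 0 ≤ Jq M G 7 t)

/-- **`OpenLayersCoreFree 7` from the residue**: the type-`2` window `(g − 7)(g − 4) < 72`, i.e. `g ≤ 14`, is the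
kernel theorem `jq_two_nonneg_of_core_seven`; the type-`1` window `(g − 7)·10 + 1 < 49` is `g ≤ 11`. -/
theorem openLayersCoreFree_seven_of_residue (h : NineSevenResidueCoreFree) : OpenLayersCoreFree 7 := by
  intro β _ M _ G hc hG _ hfree
  obtain ⟨h1, h3⟩ := h M G hc hG hfree
  refine ⟨fun _ h9 hwin => h1 h9 (by norm_num at hwin; omega), fun hwin => ?_, fun t ht3 ht => h3 t ht3 (by omega)⟩
  apply jq_two_nonneg_of_core_seven hc hG hfree
  by_contra hg
  push Not at hg
  have h8 : 8 ≤ G.card - 7 := by omega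
  have h11 : 11 ≤ G.card - 7 + 3 := by omega
  have := Nat.mul_le_mul h8 h11
  omega

/-- **C-025 at `(9, 7)` on every finite matroid** from the Core-typed layers of levels `5`, `6`, the level-`6` trace
sums and the `(9, 7)` residue on coloop-free flats. -/
theorem rls_nine_seven_of_residue {α : Type} [DecidableEq α] (h5 : OpenLayersCore 5) (h6 : OpenLayersCore 6)
    (htr : TraceSumsCore 6) (h7 : NineSevenResidueCoreFree) (M : Matroid α) [M.Finite] : RLS M 9 7 := by
  refine rls_succ_succ_of_openLayersCore 7 (by norm_num) ?_ M
  intro q' hq'5 hq'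
  rcases (show q' = 5 ∨ q' = 6 ∨ q' = 7 by omega) with rfl | rfl | rfl
  · exact h5
  · exact h6
  · exact openLayersCore_succ_of_free (by norm_num) htr (openLayersCoreFree_seven_of_residue h7)

end PercRepro.GenQ
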